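import Literature.Probability.RandomPlanarGeometry.USTPeanoTreeCount
import HarnessLib

/-!
# The bijection between Peano paths and spanning trees containing `α` ([LSW04] §4.1)

G. F. Lawler, O. Schramm, W. Werner, Ann. Probab. **32** (2004), §4.1, p. 972: "`T ↦ γ(T)` is a
bijection between the set of spanning trees of `H` containing `α` and the set of oriented paths
in `G⃗ ∩ D̄` from `a` to `b` containing `V_P`. Hence, when `T` is the UST on `H` conditioned to
contain `α`, `γ` is uniformly distributed among such Peano paths."

For good peeling data `S` we construct an explicit equivalence
`Good.pathForestEquiv : {l // S.IsPath l} ≃ Forest (S.primalGraph P₀) (S.roots P₀)` between the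
Peano paths and the rooted spanning forests of the primal graph rooted at `α` (the spanning
trees of `H` containing `α`, oriented towards `α`; `USTPeanoPrimalGraph.lean`), by recursion on
the number of interior Peano vertices, peeling off the first vertex ([LSW04] Lemma 4.1): a path
starting with the dual step `a → stepD a` corresponds to a forest in which `α_a` is the parent of
`farP a` (the tree gains the edge `f₁ = [α_a, farP a]` alongside the step) and the rest of the
path corresponds to the forest restricted to the enlarged root set `α ∪ {farP a}`
(`PeelData.pathSplit`, `Good.forestUsesEquiv`); a path starting with the primal step corresponds
to a forest avoiding `f₁`, i.e. a forest of `S.peelP` (`Good.forestDeleteEquivPeelP`); the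
degenerate cases (dangling walls, unavailable steps) are identities
(`Good.forestEquivPeelEOfEq`, `Good.forestEquivPeelP`, `Good.parent_W₀_eq`).  Being an
equivalence of finite types it transports the uniform measure on Peano paths (the UST Peano path,
`USTPeanoPath.lean`) to the uniform rooted spanning forest (`Forest.ust`, `WilsonAlgorithm.lean`;
see `USTPeanoTreeLaw.lean`).

The recursion is then unfolded (`Good.pathForestEquiv_inl_parent`, `Good.pathForestEquiv_inr_parent`:
the parent map of `T(a :: γ')` is that of `T(γ')`, with `α_a` made the parent of `farP a` after
a dual first step off `α`), which gives the non-recursive description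
`Good.tEdge_pathForestEquiv_iff`: **the tree `T(γ)` consists of `α` and the primal edges
`f₁(p) = [primalNbr p, farP p]` alongside the dual steps `p → stepD p` of `γ`** — LSW's
`T = α_{ℓ+1}`, `α_{n+1} = α_n ∪ [v_n, v_{n+1}]` (p. 972).
-/

namespace Literature.Probability.LatticeModels

open Literature.Probability.RandomPlanarGeometry RootedForest

namespace Forest

variable {V : Type*} {H H' : SimpleGraph V} {R : Finset V}

/-- The parent map is unchanged by the inverse of `adjEquiv`. [folklore] -/
@[simp] theorem adjEquiv_symm_parent (hadj : ∀ ⦃u v : V⦄, u ∉ R → (H.Adj u v ↔ H'.Adj u v))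
    (F : Forest H' R) : ((adjEquiv hadj).symm F).parent = F.parent := rfl

variable [DecidableEq V]

/-- The parent map through the deletion equivalence. [folklore] -/
@[simp] theorem parentNeEquiv_symm_parent {v u : V} (hu : u ∈ R) (hvu : v ≠ u)
    (F' : Forest (H.deleteEdges {s(v, u)}) R) :
    ((parentNeEquiv hu hvu).symm F').1.parent = F'.parent := rfl

/-- **The parent map through the contraction equivalence**: gluing the one-edge branch
`[v, u]` sets the parent of `v` to `u` and keeps the other parents. [folklore] -/
theorem parentEqEquiv_symm_parent {v u : V} (hv : v ∉ R) (hu : u ∈ R) (hadj : H.Adj v u)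
    (F' : Forest H (insert v R)) (w : V) :
    ((parentEqEquiv hv hu hadj).symm F').1.parent w = if w = v then u else F'.parent w := by
  have hnd : (v :: [u]).Nodup := by simp [hadj.ne]
  have hst : IsStoppedAt (↑R : Set V) (v :: [u]) :=
    (isStoppedAt_singleton (by exact hu)).cons (by exact hv)
  have hch : List.IsChain H.Adj (v :: [u]) := List.isChain_pair.2 hadj
  change (Forest.glue hnd hst hch ((castRoots (cov_pair_eq hu)).symm F')).parent w = _
  rw [glue_parent]
  split_ifs with hw
  · subst hw
    exact RootedForest.glue_of_pathSucc _ (by simp [RootedForest.pathSucc_cons_cons])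
  · rw [RootedForest.glue_of_not_mem _ (by simp [hw]), castRoots_symm_parent]

end Forest

end Literature.Probability.LatticeModels

namespace Literature.Probability.RandomPlanarGeometry

namespace USTPeano

open Literature.Probability.LatticeModels

namespace PeelData

variable {P₀ : Finset (ℤ × ℤ)}

/-- A `Unique` structure on a type with exactly one element. [folklore] -/
@[reducible] noncomputable def uniqueOfCardEqOne {X : Type*} (h : Nat.card X = 1) : Unique X :=
  haveI := (Nat.card_eq_one_iff_unique.1 h).1
  haveI : Inhabited X := ⟨Classical.choice (Nat.card_eq_one_iff_unique.1 h).2⟩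
  Unique.mk' X

open Classical in
/-- **The bijection between Peano paths and spanning trees containing `α`** ([LSW04] §4.1,
"`T ↦ γ(T)` is a bijection"), for good peeling data, by recursion on the number of interior
Peano vertices along the peeling of the first vertex (Lemma 4.1): dual first step ↔ `α_a` is the
parent of `farP a` and the rest is the forest rooted at `α ∪ {farP a}`; primal first step ↔ the
forest avoids `f₁`. [cite: LawlerSchrammWerner2004, §4.1] -/
noncomputable def Good.pathForestEquiv :
    ∀ (S : PeelData) (_ : S.Good) (_ : S.amb ⊆ P₀),
      {l // S.IsPath l} ≃ Forest (S.primalGraph P₀) (S.roots P₀)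
  | S, h, hP =>
    if hV : S.V = ∅ then
      haveI := uniqueOfCardEqOne (card_isPath_of_empty h hV)
      haveI := uniqueOfCardEqOne (card_forest_of_V_eq_empty hV P₀)
      Equiv.ofUnique _ _
    else if h2 : s(dualNbr S.a, farD S.a) ∈ edgeSet S.β then
      -- case D: the dual step is blocked, the primal step is available
      have hnE : ¬ S.CanE := fun hE ↦ hE.1 h2
      have hE : S.swap.CanE := h.canE_or.resolve_left hnE
      have hb : stepD S.swap.a ≠ S.swap.b := h.swap.stepD_ne_b (swap_V_ne_empty hV) hE
      haveI : IsEmpty {l // S.CanE ∧ S.peelE.IsPath l} := ⟨fun x ↦ hnE x.2.1⟩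
      (pathSplit h hV).trans <| (Equiv.emptySum _ _).trans <|
        ((Equiv.subtypeEquivRight fun _ ↦ and_iff_right hE).trans
          (isPathSwapEquiv S.swap.peelE).symm).trans <|
          (pathForestEquiv S.peelP (h.peelP_good hE hb) ((h.amb_peelP_subset hE hb).trans hP)).trans
            (h.forestEquivPeelP hE hb (Or.inr h2)).symm
    else if hn : farP S.a ∈ S.α then
      if hB : ∃ t, S.α = primalNbr S.a :: farP S.a :: t then
        -- case B: dual step along the dangling first edge of `α`
        have hE : S.CanE := ⟨h2, Or.inr hB⟩
        have hb : stepD S.a ≠ S.b := h.stepD_ne_b hV hE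
        have hnP : ¬ S.swap.CanE := fun hE' ↦ (canE_swap_iff.1 hE').1 (by
          rw [Classical.choose_spec hB, edgeSet_cons_cons]; exact List.mem_cons_self)
        haveI : IsEmpty {l // S.swap.CanE ∧ S.swap.peelE.IsPath l} := ⟨fun x ↦ hnP x.2.1⟩
        (pathSplit h hV).trans <| (Equiv.sumEmpty _ _).trans <|
          (Equiv.subtypeEquivRight fun _ ↦ and_iff_right hE).trans <|
            (pathForestEquiv S.peelE (h.peelE hE hb) ((h.amb_peelE_subset hE hb).trans hP)).trans
              (h.forestEquivPeelEOfEq hE hb (Classical.choose_spec hB)).symm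
      else
        -- case C: `farP a` deep inside `α`, only the primal step is available
        have hnE : ¬ S.CanE := fun hE ↦ hE.2.elim (fun h' ↦ h' hn) hB
        have hE : S.swap.CanE := h.canE_or.resolve_left hnE
        have hb : stepD S.swap.a ≠ S.swap.b := h.swap.stepD_ne_b (swap_V_ne_empty hV) hE
        haveI : IsEmpty {l // S.CanE ∧ S.peelE.IsPath l} := ⟨fun x ↦ hnE x.2.1⟩
        (pathSplit h hV).trans <| (Equiv.emptySum _ _).trans <|
          ((Equiv.subtypeEquivRight fun _ ↦ and_iff_right hE).trans
            (isPathSwapEquiv S.swap.peelE).symm).trans <|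
            (pathForestEquiv S.peelP (h.peelP_good hE hb) ((h.amb_peelP_subset hE hb).trans hP)).trans
              (h.forestEquivPeelP hE hb (Or.inl hn)).symm
    else
      -- case A: the dual step is available and adds `farP a` to `α`
      have hE : S.CanE := ⟨h2, Or.inl hn⟩
      have hb : stepD S.a ≠ S.b := h.stepD_ne_b hV hE
      have h1 : s(primalNbr S.a, farP S.a) ∉ edgeSet S.α := fun hm ↦ hn (mem_of_mem_edgeSet hm).2
      let eE : {l // S.CanE ∧ S.peelE.IsPath l} ≃
          {F : Forest (S.primalGraph P₀) (S.roots P₀) // F.parent (S.W₀ hP) = S.U₀ hP} :=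
        (Equiv.subtypeEquivRight fun _ ↦ and_iff_right hE).trans <|
          (pathForestEquiv S.peelE (h.peelE hE hb) ((h.amb_peelE_subset hE hb).trans hP)).trans
            (h.forestUsesEquiv hP hE hb hn).symm
      let eP : {l // S.swap.CanE ∧ S.swap.peelE.IsPath l} ≃
          {F : Forest (S.primalGraph P₀) (S.roots P₀) // F.parent (S.W₀ hP) ≠ S.U₀ hP} :=
        if hfar : farD S.a ∈ S.β then
          -- case C': the primal step is unavailable; every forest uses `f₁`
          have hnP : ¬ S.swap.CanE := fun hE' ↦ by
            rcases (canE_swap_iff.1 hE').2 with hn' | ⟨t, ht⟩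
            · exact hn' hfar
            · exact h2 (by rw [ht, edgeSet_cons_cons]; exact List.mem_cons_self)
          haveI : IsEmpty {l // S.swap.CanE ∧ S.swap.peelE.IsPath l} := ⟨fun x ↦ hnP x.2.1⟩
          haveI : IsEmpty {F : Forest (S.primalGraph P₀) (S.roots P₀) // F.parent (S.W₀ hP) ≠ S.U₀ hP} :=
            ⟨fun F ↦ F.2 (h.parent_W₀_eq hP h2 hn hfar F.1)⟩
          Equiv.equivOfIsEmpty _ _
        else
          -- case A': the primal step is available; forests avoiding `f₁` = forests of `peelP`
          have hE' : S.swap.CanE := canE_swap_iff.2 ⟨h1, Or.inl hfar⟩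
          have hb' : stepD S.swap.a ≠ S.swap.b := h.swap.stepD_ne_b (swap_V_ne_empty hV) hE'
          ((Equiv.subtypeEquivRight fun _ ↦ and_iff_right hE').trans
            (isPathSwapEquiv S.swap.peelE).symm).trans <|
            (pathForestEquiv S.peelP (h.peelP_good hE' hb') ((h.amb_peelP_subset hE' hb').trans hP)).trans <|
              (h.forestDeleteEquivPeelP hP hE' hb').symm.trans (h.forestAvoidsEquivDelete hP).symm
      (pathSplit h hV).trans <| (Equiv.sumCongr eE eP).trans (Forest.splitParent (S.W₀ hP) (S.U₀ hP)).symm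
  termination_by S => S.V.card
  decreasing_by
    all_goals first
      | (apply Good.card_peelP_lt <;> assumption)
      | (apply Good.card_peelE_lt <;> assumption)

/-- **Peano paths and spanning trees containing `α` are in bijection**, as a bare statement.
[cite: LawlerSchrammWerner2004, §4.1] -/
theorem Good.nonempty_equiv_forest {S : PeelData} (h : S.Good) (hP : S.amb ⊆ P₀) :
    Nonempty ({l // S.IsPath l} ≃ Forest (S.primalGraph P₀) (S.roots P₀)) :=
  ⟨Good.pathForestEquiv S h hP⟩

/-! ### Unfolding the bijection along the first step

The bijection was built by recursion through `pathSplit`; we record how the parent map of the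
forest `T(γ)` is obtained from that of the forest of the peeled path: after a dual first step
the edge `f₁ = [α_a, farP a]` is added (unless `farP a` already lies on `α`), after a primal first
step nothing is added. -/


variable {S : PeelData}

/-- The parent map through the case-A equivalence: `α_a` becomes the parent of `farP a`.
[folklore] -/
theorem Good.forestUsesEquiv_symm_parent (h : S.Good) (hP : S.amb ⊆ P₀) (hE : S.CanE)
    (hb : stepD S.a ≠ S.b) (hn : farP S.a ∉ S.α)
    (F' : Forest (S.peelE.primalGraph P₀) (S.peelE.roots P₀)) (w : ↥P₀) :
    ((h.forestUsesEquiv hP hE hb hn).symm F').1.parent w =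
      if w = S.W₀ hP then S.U₀ hP else F'.parent w := by
  simp only [Good.forestUsesEquiv, Equiv.symm_trans_apply, Forest.parentEqEquiv_symm_parent,
    Forest.castRoots_symm_parent, Forest.adjEquiv_symm_parent]

/-- The parent map through the deletion equivalences (primal first step, case A′). [folklore] -/
theorem Good.forestDeleteEquivPeelP_symm_parent (h : S.Good) (hP : S.amb ⊆ P₀) (hE : S.swap.CanE)
    (hb : stepD S.swap.a ≠ S.swap.b) (F' : Forest (S.peelP.primalGraph P₀) (S.peelP.roots P₀)) :
    ((h.forestAvoidsEquivDelete hP).symm ((h.forestDeleteEquivPeelP hP hE hb).symm F')).1.parent =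
      F'.parent := by
  rw [Good.forestAvoidsEquivDelete, Forest.parentNeEquiv_symm_parent, Good.forestDeleteEquivPeelP]
  simp only [Equiv.symm_trans_apply, Forest.castRoots_symm_parent, Forest.adjEquiv_symm_parent]

/-- The parent map through the case-B equivalence. [folklore] -/
theorem Good.forestEquivPeelEOfEq_symm_parent (h : S.Good) (hE : S.CanE) (hb : stepD S.a ≠ S.b)
    {t : List (ℤ × ℤ)} (ht : S.α = primalNbr S.a :: farP S.a :: t)
    (F' : Forest (S.peelE.primalGraph P₀) (S.peelE.roots P₀)) :
    ((h.forestEquivPeelEOfEq (P₀ := P₀) hE hb ht).symm F').parent = F'.parent := by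
  simp only [Good.forestEquivPeelEOfEq, Equiv.symm_trans_apply, Forest.castRoots_symm_parent,
    Forest.adjEquiv_symm_parent]

/-- The parent map through the cases-C/D equivalence. [folklore] -/
theorem Good.forestEquivPeelP_symm_parent (h : S.Good) (hE : S.swap.CanE)
    (hb : stepD S.swap.a ≠ S.swap.b) (hC : farP S.a ∈ S.α ∨ s(dualNbr S.a, farD S.a) ∈ edgeSet S.β)
    (F' : Forest (S.peelP.primalGraph P₀) (S.peelP.roots P₀)) :
    ((h.forestEquivPeelP (P₀ := P₀) hE hb hC).symm F').parent = F'.parent := by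
  simp only [Good.forestEquivPeelP, Equiv.symm_trans_apply, Forest.castRoots_symm_parent,
    Forest.adjEquiv_symm_parent]

/-- The peeled path after a dual first step, as a Peano path of `S.peelE`. [folklore] -/
def tailE (x : {l // S.CanE ∧ S.peelE.IsPath l}) : {l // S.peelE.IsPath l} := ⟨x.1, x.2.2⟩

/-- The vertex list of `tailE x`. [folklore] -/
@[simp] theorem tailE_val (x : {l // S.CanE ∧ S.peelE.IsPath l}) : (tailE x).1 = x.1 := rfl

/-- The peeled path after a primal first step, as a Peano path of `S.peelP` (un-exchanged).
[folklore] -/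
def tailP (x : {l // S.swap.CanE ∧ S.swap.peelE.IsPath l}) : {l // S.peelP.IsPath l} :=
  (isPathSwapEquiv S.swap.peelE).symm ⟨x.1, x.2.2⟩

/-- The vertex list of `tailP x` is the exchanged list. [folklore] -/
@[simp] theorem tailP_val (x : {l // S.swap.CanE ∧ S.swap.peelE.IsPath l}) :
    (tailP x).1 = x.1.map swapIdx := rfl

/-- The path with a dual first step and peeled tail `x` is `a :: x`. [folklore] -/
@[simp] theorem pathSplit_symm_inl_val (h : S.Good) (hV : S.V ≠ ∅)
    (x : {l // S.CanE ∧ S.peelE.IsPath l}) : ((pathSplit h hV).symm (Sum.inl x)).1 = S.a :: x.1 := rfl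

/-- The path with a primal first step and (exchanged) peeled tail `x` is `a :: x.map swapIdx`.
[folklore] -/
@[simp] theorem pathSplit_symm_inr_val (h : S.Good) (hV : S.V ≠ ∅)
    (x : {l // S.swap.CanE ∧ S.swap.peelE.IsPath l}) :
    ((pathSplit h hV).symm (Sum.inr x)).1 = S.a :: x.1.map swapIdx := by
  change (S.swap.a :: x.1).map swapIdx = _
  rw [List.map_cons, swap_a, swapIdx_swapIdx]

/-- **Unfolding `T` after a dual first step**: the forest of the path `a :: x` (dual step
`a → stepD a`, then the Peano path `x` of `S.peelE`) is the forest of `x` with, when `farP a ∉ α`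
(case A), the edge `f₁`: `α_a` made the parent of `farP a`; in the dangling case B
(`farP a ∈ α`) the parent maps agree. [cite: LawlerSchrammWerner2004, §4.1] -/
theorem Good.pathForestEquiv_inl_parent (h : S.Good) (hP : S.amb ⊆ P₀) (hV : S.V ≠ ∅)
    (x : {l // S.CanE ∧ S.peelE.IsPath l}) (w : ↥P₀) :
    (Good.pathForestEquiv S h hP ((pathSplit h hV).symm (Sum.inl x))).parent w =
      if w = S.W₀ hP ∧ farP S.a ∉ S.α then (S.U₀ hP : ↥P₀) else
        (Good.pathForestEquiv S.peelE (h.peelE x.2.1 (h.stepD_ne_b hV x.2.1))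
          ((h.amb_peelE_subset x.2.1 (h.stepD_ne_b hV x.2.1)).trans hP) (tailE x)).parent w := by
  have hE : S.CanE := x.2.1
  have h2 : s(dualNbr S.a, farD S.a) ∉ edgeSet S.β := hE.1
  rw [Good.pathForestEquiv.eq_1 S h hP, dif_neg hV, dif_neg h2]
  by_cases hn : farP S.a ∈ S.α
  · -- case B
    have hB : ∃ t, S.α = primalNbr S.a :: farP S.a :: t := hE.2.resolve_left fun h' ↦ h' hn
    rw [dif_pos hn, dif_pos hB, if_neg fun hw ↦ hw.2 hn]
    simp only [Equiv.trans_apply, Equiv.apply_symm_apply, Equiv.sumEmpty_apply_inl,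
      Equiv.subtypeEquivRight_apply, h.forestEquivPeelEOfEq_symm_parent]
    rfl
  · -- case A
    rw [dif_neg hn]
    simp only [Equiv.trans_apply, Equiv.apply_symm_apply, Equiv.sumCongr_apply, Sum.map_inl,
      Forest.splitParent, Equiv.symm_symm, Equiv.sumCompl_apply_inl, Equiv.subtypeEquivRight_apply,
      h.forestUsesEquiv_symm_parent]
    by_cases hw : w = S.W₀ hP
    · rw [if_pos hw, if_pos ⟨hw, hn⟩]
    · rw [if_neg hw, if_neg fun hw' ↦ hw hw'.1]
      rfl

/-- **Unfolding `T` after a primal first step**: the forest of the path `a :: x.map swapIdx`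
(primal step `a → stepP a`, then the Peano path of `S.peelP`) has the same parent map as the
forest of the peeled path (no edge is added alongside a primal step).
[cite: LawlerSchrammWerner2004, §4.1] -/
theorem Good.pathForestEquiv_inr_parent (h : S.Good) (hP : S.amb ⊆ P₀) (hV : S.V ≠ ∅)
    (x : {l // S.swap.CanE ∧ S.swap.peelE.IsPath l}) :
    (Good.pathForestEquiv S h hP ((pathSplit h hV).symm (Sum.inr x))).parent =
      (Good.pathForestEquiv S.peelP
        (h.peelP_good x.2.1 (h.swap.stepD_ne_b (swap_V_ne_empty hV) x.2.1))
        ((h.amb_peelP_subset x.2.1 (h.swap.stepD_ne_b (swap_V_ne_empty hV) x.2.1)).trans hP)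
        (tailP x)).parent := by
  have hE' : S.swap.CanE := x.2.1
  have hb' : stepD S.swap.a ≠ S.swap.b := h.swap.stepD_ne_b (swap_V_ne_empty hV) hE'
  rw [Good.pathForestEquiv.eq_1 S h hP, dif_neg hV]
  by_cases h2 : s(dualNbr S.a, farD S.a) ∈ edgeSet S.β
  · -- case D
    rw [dif_pos h2]
    simp only [Equiv.trans_apply, Equiv.apply_symm_apply, Equiv.emptySum_apply_inr,
      Equiv.subtypeEquivRight_apply]
    -- (`S.peelP` is `S.swap.peelE.swap` only up to unfolding: finish definitionally)
    change ((h.forestEquivPeelP hE' hb' (Or.inr h2)).symm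
      (Good.pathForestEquiv S.peelP (h.peelP_good hE' hb') ((h.amb_peelP_subset hE' hb').trans hP)
        (tailP x))).parent = _
    rw [h.forestEquivPeelP_symm_parent]
  rw [dif_neg h2]
  by_cases hn : farP S.a ∈ S.α
  · have hB : ¬ ∃ t, S.α = primalNbr S.a :: farP S.a :: t := by
      rintro ⟨t, ht⟩
      exact (canE_swap_iff.1 hE').1 (by rw [ht, edgeSet_cons_cons]; exact List.mem_cons_self)
    -- case C
    rw [dif_pos hn, dif_neg hB]
    simp only [Equiv.trans_apply, Equiv.apply_symm_apply, Equiv.emptySum_apply_inr,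
      Equiv.subtypeEquivRight_apply]
    change ((h.forestEquivPeelP hE' hb' (Or.inl hn)).symm
      (Good.pathForestEquiv S.peelP (h.peelP_good hE' hb') ((h.amb_peelP_subset hE' hb').trans hP)
        (tailP x))).parent = _
    rw [h.forestEquivPeelP_symm_parent]
  · -- case A, sub-case A′ (the primal step is available: `farD a ∉ β`)
    have hfar : farD S.a ∉ S.β := fun hfar ↦ by
      rcases (canE_swap_iff.1 hE').2 with hn' | ⟨t, ht⟩
      · exact hn' hfar
      · exact h2 (by rw [ht, edgeSet_cons_cons]; exact List.mem_cons_self)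
    rw [dif_neg hn]
    simp only [Equiv.trans_apply, Equiv.apply_symm_apply, Equiv.sumCongr_apply, Sum.map_inr,
      Forest.splitParent, Equiv.symm_symm, Equiv.sumCompl_apply_inr, dif_neg hfar,
      Equiv.subtypeEquivRight_apply]
    change ((h.forestAvoidsEquivDelete hP).symm ((h.forestDeleteEquivPeelP hP hE' hb').symm
      (Good.pathForestEquiv S.peelP (h.peelP_good hE' hb') ((h.amb_peelP_subset hE' hb').trans hP)
        (tailP x)))).1.parent = _
    rw [h.forestDeleteEquivPeelP_symm_parent]

/-- **Unfolding `T` after a dual first step (case A), at `farP a`**: `α_a` is the parent of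
`farP a`. [cite: LawlerSchrammWerner2004, §4.1] -/
theorem Good.pathForestEquiv_inl_parent_W₀ (h : S.Good) (hP : S.amb ⊆ P₀) (hV : S.V ≠ ∅)
    (x : {l // S.CanE ∧ S.peelE.IsPath l}) (hn : farP S.a ∉ S.α) :
    (Good.pathForestEquiv S h hP ((pathSplit h hV).symm (Sum.inl x))).parent (S.W₀ hP) = S.U₀ hP := by
  rw [h.pathForestEquiv_inl_parent hP hV, if_pos ⟨rfl, hn⟩]

/-! ### The same, for a path given with its first step -/

/-- After a primal first step the dual step of the exchanged data is available. [folklore] -/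
theorem IsPath.swap_canE_of_head_stepP (h : S.Good) {γ : List (ℤ × ℤ)} (hγ : S.IsPath γ)
    (hp : γ.tail.head (hγ.tail_ne_nil h) = stepP S.a) : S.swap.CanE := by
  have hl' : S.swap.IsPath (S.swap.a :: γ.tail.map swapIdx) := by simpa using hγ.cons_tail.swap
  have hne' : γ.tail.map swapIdx ≠ [] := by
    rw [ne_eq, List.map_eq_nil_iff]
    exact hγ.tail_ne_nil h
  exact hl'.canE_of_head h.swap hne' (by rw [List.head_map, hp, swap_a, stepD_swapIdx])

/-- After a primal first step the exchanged tail is a Peano path of `S.swap.peelE`. [folklore] -/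
theorem IsPath.swap_peelE_of_head_stepP (h : S.Good) {γ : List (ℤ × ℤ)} (hγ : S.IsPath γ)
    (hp : γ.tail.head (hγ.tail_ne_nil h) = stepP S.a) : S.swap.peelE.IsPath (γ.tail.map swapIdx) := by
  have hl' : S.swap.IsPath (S.swap.a :: γ.tail.map swapIdx) := by simpa using hγ.cons_tail.swap
  have hne' : γ.tail.map swapIdx ≠ [] := by
    rw [ne_eq, List.map_eq_nil_iff]
    exact hγ.tail_ne_nil h
  exact hl'.tail_peelE h.swap hne' (by rw [List.head_map, hp, swap_a, stepD_swapIdx])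

/-- **After a primal first step the tail is a Peano path of `S.peelP`.** [cite: LawlerSchrammWerner2004, Lemma 4.1] -/
theorem IsPath.tail_peelP (h : S.Good) {γ : List (ℤ × ℤ)} (hγ : S.IsPath γ)
    (hp : γ.tail.head (hγ.tail_ne_nil h) = stepP S.a) : S.peelP.IsPath γ.tail := by
  have := (hγ.swap_peelE_of_head_stepP h hp).swap
  rwa [map_swapIdx_map_swapIdx] at this

/-- A path with a dual first step, through `pathSplit`. [folklore] -/
theorem pathSplit_symm_inl_eq (h : S.Good) (hV : S.V ≠ ∅) (γ : {l // S.IsPath l})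
    (hd : γ.1.tail.head (γ.2.tail_ne_nil h) = stepD S.a) :
    (pathSplit h hV).symm (Sum.inl ⟨γ.1.tail, γ.2.cons_tail.canE_of_head h (γ.2.tail_ne_nil h) hd,
      γ.2.cons_tail.tail_peelE h (γ.2.tail_ne_nil h) hd⟩) = γ :=
  Subtype.ext γ.2.eq_cons.symm

/-- A path with a primal first step, through `pathSplit`. [folklore] -/
theorem pathSplit_symm_inr_eq (h : S.Good) (hV : S.V ≠ ∅) (γ : {l // S.IsPath l})
    (hp : γ.1.tail.head (γ.2.tail_ne_nil h) = stepP S.a) :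
    (pathSplit h hV).symm (Sum.inr ⟨γ.1.tail.map swapIdx, γ.2.swap_canE_of_head_stepP h hp,
      γ.2.swap_peelE_of_head_stepP h hp⟩) = γ := by
  refine Subtype.ext ?_
  rw [pathSplit_symm_inr_val, map_swapIdx_map_swapIdx]
  exact γ.2.eq_cons.symm

/-- **Unfolding `T` at a path with a dual first step**: the parent map of `T(γ)` is that of the
forest of `γ.tail` (a Peano path of `S.peelE`), with `α_a` made the parent of `farP a` when
`farP a ∉ α`. [cite: LawlerSchrammWerner2004, §4.1] -/
theorem Good.pathForestEquiv_parent_of_stepD (h : S.Good) (hP : S.amb ⊆ P₀) (hV : S.V ≠ ∅)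
    (γ : {l // S.IsPath l}) (hd : γ.1.tail.head (γ.2.tail_ne_nil h) = stepD S.a) (w : ↥P₀) :
    haveI hE : S.CanE := γ.2.cons_tail.canE_of_head h (γ.2.tail_ne_nil h) hd
    haveI hb : stepD S.a ≠ S.b := h.stepD_ne_b hV hE
    (Good.pathForestEquiv S h hP γ).parent w =
      if w = S.W₀ hP ∧ farP S.a ∉ S.α then (S.U₀ hP : ↥P₀) else
        (Good.pathForestEquiv S.peelE (h.peelE hE hb) ((h.amb_peelE_subset hE hb).trans hP)
          ⟨γ.1.tail, γ.2.cons_tail.tail_peelE h (γ.2.tail_ne_nil h) hd⟩).parent w := by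
  have := h.pathForestEquiv_inl_parent hP hV ⟨γ.1.tail,
    γ.2.cons_tail.canE_of_head h (γ.2.tail_ne_nil h) hd,
    γ.2.cons_tail.tail_peelE h (γ.2.tail_ne_nil h) hd⟩ w
  rwa [pathSplit_symm_inl_eq h hV γ hd] at this

/-- **Unfolding `T` at a path with a primal first step**: the parent map of `T(γ)` is that of
the forest of `γ.tail` (a Peano path of `S.peelP`). [cite: LawlerSchrammWerner2004, §4.1] -/
theorem Good.pathForestEquiv_parent_of_stepP (h : S.Good) (hP : S.amb ⊆ P₀) (hV : S.V ≠ ∅)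
    (γ : {l // S.IsPath l}) (hp : γ.1.tail.head (γ.2.tail_ne_nil h) = stepP S.a) :
    haveI hE' : S.swap.CanE := γ.2.swap_canE_of_head_stepP h hp
    haveI hb' : stepD S.swap.a ≠ S.swap.b := h.swap.stepD_ne_b (swap_V_ne_empty hV) hE'
    (Good.pathForestEquiv S h hP γ).parent =
      (Good.pathForestEquiv S.peelP (h.peelP_good hE' hb') ((h.amb_peelP_subset hE' hb').trans hP)
        ⟨γ.1.tail, γ.2.tail_peelP h hp⟩).parent := by
  have := h.pathForestEquiv_inr_parent hP hV ⟨γ.1.tail.map swapIdx,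
    γ.2.swap_canE_of_head_stepP h hp, γ.2.swap_peelE_of_head_stepP h hp⟩
  rw [pathSplit_symm_inr_eq h hV γ hp] at this
  rw [this]
  congr 2
  exact Subtype.ext (map_swapIdx_map_swapIdx _)

/-! ### The tree of a Peano path: its edges are the primal edges alongside the dual steps

Unwinding the recursion: the forest `T(γ)` consists of `α` (its roots) and exactly the primal
edges `f₁(p) = [primalNbr p, farP p]` alongside the dual steps `p → stepD p` of `γ` that are not
already edges of `α` — LSW's description of `T(γ)` ("`α_{n+1} = α_n ∪ [v_n, v_{n+1}]` if
`{w_n, w_{n+1}}` does not intersect `α`", with `T = α_{ℓ+1}`), and conversely the description of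
`γ(T)` as the path crossing neither `T` nor its dual. -/

/-- **The primal edges alongside the dual steps** of a vertex list of `G⃗`:
`{f₁(p) : p → stepD p is a step of l}`. [cite: LawlerSchrammWerner2004, §4.1] -/
def dualStepEdges (l : List (ℤ × ℤ)) : Set (Sym2 (ℤ × ℤ)) :=
  {e | ∃ p, (p, stepD p) ∈ l.zip l.tail ∧ e = s(primalNbr p, farP p)}

/-- The edges alongside the dual steps of `x :: y :: t`. [folklore] -/
theorem mem_dualStepEdges_cons_cons {x y : ℤ × ℤ} {t : List (ℤ × ℤ)} {e : Sym2 (ℤ × ℤ)} :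
    e ∈ dualStepEdges (x :: y :: t) ↔
      (y = stepD x ∧ e = s(primalNbr x, farP x)) ∨ e ∈ dualStepEdges (y :: t) := by
  simp only [dualStepEdges, Set.mem_setOf_eq, List.zip_cons_cons, List.tail_cons, List.mem_cons,
    Prod.mk.injEq]
  constructor
  · rintro ⟨p, ⟨rfl, hq⟩ | hq, rfl⟩
    · exact Or.inl ⟨hq.symm, rfl⟩
    · exact Or.inr ⟨p, hq, rfl⟩
  · rintro (⟨hy, rfl⟩ | ⟨p, hq, rfl⟩)
    · exact ⟨x, Or.inl ⟨rfl, hy.symm⟩, rfl⟩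
    · exact ⟨p, Or.inr hq, rfl⟩

/-- **The edges of a forest of `H(S)`**, as primal lattice edges: `{w, parent w}` for the
non-roots `w`. [folklore] -/
def TEdge (S : PeelData) (F : Forest (S.primalGraph P₀) (S.roots P₀)) (e : Sym2 (ℤ × ℤ)) : Prop :=
  ∃ w, w ∉ S.roots P₀ ∧ e = s(w.1, (F.parent w).1)

/-- **The tree of a Peano path consists of `α` and the primal edges alongside its dual steps**:
the edges of the forest `T(γ)` (from non-roots to their parents) are exactly the edges
`f₁(p) = [primalNbr p, farP p]` alongside the dual steps `p → stepD p` of `γ` which are not edges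
of `α`. [cite: LawlerSchrammWerner2004, §4.1] -/
theorem Good.tEdge_pathForestEquiv_iff :
    ∀ (S : PeelData) (h : S.Good) (hP : S.amb ⊆ P₀) (γ : {l // S.IsPath l}) (e : Sym2 (ℤ × ℤ)),
      S.TEdge (Good.pathForestEquiv S h hP γ) e ↔ e ∈ dualStepEdges γ.1 ∧ e ∉ edgeSet S.α
  | S, h, hP, γ, e => by
    by_cases hV : S.V = ∅
    · -- no interior vertex: every vertex is a root and `γ = [a, b]`
      have hall : ∀ u : ↥P₀, u ∈ S.roots P₀ := fun u ↦ mem_roots_of_V_eq_empty hV u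
      constructor
      · rintro ⟨w, hw, -⟩
        exact (hw (hall w)).elim
      · rintro ⟨⟨p, hp, rfl⟩, hα⟩
        exfalso
        rw [γ.2.eq_pair_of_empty h hV] at hp
        simp only [List.zip_cons_cons, List.tail_cons, List.zip_nil_right, List.mem_singleton,
          Prod.mk.injEq] at hp
        obtain ⟨rfl, hb⟩ := hp
        refine hα ((S.blocked_stepP_iff S.a).1 ?_)
        by_contra hub
        rcases h.closed S.a (Or.inl rfl) (stepP S.a) ((manhattan_iff_step _ _).2 (Or.inr rfl)) hub
          with h1 | h1
        · exact stepD_ne_stepP S.a (hb.trans h1.symm)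
        · simp [hV] at h1
    · obtain ⟨y, rfl⟩ : ∃ y, γ = (pathSplit h hV).symm y :=
        ⟨_, ((pathSplit h hV).symm_apply_apply γ).symm⟩
      rcases y with x | x
      · -- dual first step
        have hE : S.CanE := x.2.1
        have hb : stepD S.a ≠ S.b := h.stepD_ne_b hV hE
        have IH := tEdge_pathForestEquiv_iff S.peelE (h.peelE hE hb)
          ((h.amb_peelE_subset hE hb).trans hP) (tailE x) e
        rw [TEdge, tailE_val] at IH
        have hx : x.1 = stepD S.a :: x.1.tail := x.2.2.eq_cons
        have hds : e ∈ dualStepEdges (S.a :: x.1) ↔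
            e = s(primalNbr S.a, farP S.a) ∨ e ∈ dualStepEdges x.1 := by
          rw [hx, mem_dualStepEdges_cons_cons]
          simp
        simp only [TEdge, h.pathForestEquiv_inl_parent hP hV, pathSplit_symm_inl_val]
        rw [hds]
        by_cases hn : farP S.a ∈ S.α
        · -- case B: `[α_a, farP a]` is the dangling first edge of `α`; no edge is added
          obtain ⟨t, ht⟩ : ∃ t, S.α = primalNbr S.a :: farP S.a :: t :=
            hE.2.resolve_left fun h' ↦ h' hn
          have hr : ∀ w : ↥P₀, w ∈ S.peelE.roots P₀ ↔ w ∈ S.roots P₀ := fun w ↦ by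
            rw [h.roots_peelE_of_eq hE hb ht]
          have hαe : edgeSet S.α = s(primalNbr S.a, farP S.a) :: edgeSet S.peelE.α := by
            rw [peelE_α_of_eq ht, ht, edgeSet_cons_cons]
          have hroot : ∀ (w : ↥P₀) (v : ℤ × ℤ), s(w.1, v) = s(primalNbr S.a, farP S.a) →
              w ∈ S.roots P₀ := by
            intro w v hwv
            rw [mem_roots]
            left
            rcases Sym2.eq_iff.1 hwv with ⟨h1, -⟩ | ⟨h1, -⟩
            · rw [h1]; exact h.primalNbr_a_mem
            · rw [h1]; exact hn
          simp only [hn, not_true_eq_false, and_false, ↓reduceIte]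
          constructor
          · rintro ⟨w, hw, hwe⟩
            have h1 := IH.1 ⟨w, fun hw' ↦ hw ((hr w).1 hw'), hwe⟩
            refine ⟨Or.inr h1.1, ?_⟩
            rw [hαe, List.mem_cons, not_or]
            exact ⟨fun he ↦ hw (hroot w _ (hwe.symm.trans he)), h1.2⟩
          · rintro ⟨hd, hne⟩
            rw [hαe, List.mem_cons, not_or] at hne
            obtain ⟨w, hw, hwe⟩ := IH.2 ⟨hd.resolve_left hne.1, hne.2⟩
            exact ⟨w, fun hw' ↦ hw ((hr w).2 hw'), hwe⟩
        · -- case A: the edge `f₁ = [α_a, farP a]` is added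
          have hr : ∀ w : ↥P₀, w ∈ S.peelE.roots P₀ ↔ w.1 = farP S.a ∨ w ∈ S.roots P₀ := fun w ↦
            h.mem_roots_peelE_of_notMem hE hb hn
          obtain ⟨l, hl⟩ := h.α_eq_cons
          have hαe : edgeSet S.peelE.α = s(farP S.a, primalNbr S.a) :: edgeSet S.α := by
            rw [peelE_α_of_notMem hn, hl, edgeSet_cons_cons]
          have hf₁ : s(primalNbr S.a, farP S.a) ∉ edgeSet S.α := fun hm ↦ hn (mem_of_mem_edgeSet hm).2
          have hW₀ : S.W₀ hP ∉ S.roots P₀ := h.W₀_not_mem_roots hP hE.1 hn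
          simp only [hn, not_false_eq_true, and_true]
          constructor
          · rintro ⟨w, hw, hwe⟩
            by_cases hwW : w = S.W₀ hP
            · rw [if_pos hwW, hwW] at hwe
              have he : e = s(primalNbr S.a, farP S.a) := hwe.trans Sym2.eq_swap
              refine ⟨Or.inl he, ?_⟩
              rw [he]
              exact hf₁
            · rw [if_neg hwW] at hwe
              have hw' : w ∉ S.peelE.roots P₀ := fun h' ↦ by
                rcases (hr w).1 h' with h1 | h1
                · exact hwW (Subtype.ext h1)
                · exact hw h1
              have h1 := IH.1 ⟨w, hw', hwe⟩
              refine ⟨Or.inr h1.1, fun he ↦ h1.2 ?_⟩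
              rw [hαe]
              exact List.mem_cons_of_mem _ he
          · rintro ⟨hd, hne⟩
            by_cases he : e = s(primalNbr S.a, farP S.a)
            · refine ⟨S.W₀ hP, hW₀, ?_⟩
              rw [if_pos rfl, he]
              exact Sym2.eq_swap
            · have hne' : e ∉ edgeSet S.peelE.α := by
                rw [hαe, List.mem_cons, not_or]
                exact ⟨fun h' ↦ he (h'.trans Sym2.eq_swap), hne⟩
              obtain ⟨w, hw, hwe⟩ := IH.2 ⟨hd.resolve_left he, hne'⟩
              have hwW : w ≠ S.W₀ hP := fun h' ↦ hw ((hr w).2 (Or.inl (by rw [h']; rfl)))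
              refine ⟨w, fun h' ↦ hw ((hr w).2 (Or.inr h')), ?_⟩
              rw [if_neg hwW]
              exact hwe
      · -- primal first step: no edge is added
        have hE' : S.swap.CanE := x.2.1
        have hb' : stepD S.swap.a ≠ S.swap.b := h.swap.stepD_ne_b (swap_V_ne_empty hV) hE'
        have IH := tEdge_pathForestEquiv_iff S.peelP (h.peelP_good hE' hb')
          ((h.amb_peelP_subset hE' hb').trans hP) (tailP x) e
        have hx : x.1 = stepD S.swap.a :: x.1.tail := x.2.2.eq_cons
        have hds : e ∈ dualStepEdges (S.a :: x.1.map swapIdx) ↔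
            e ∈ dualStepEdges (x.1.map swapIdx) := by
          rw [hx, List.map_cons, swap_a, stepD_swapIdx, swapIdx_swapIdx,
            mem_dualStepEdges_cons_cons, or_iff_right]
          exact fun h' ↦ stepD_ne_stepP S.a h'.1.symm
        rw [TEdge, h.pathForestEquiv_inr_parent hP hV, pathSplit_symm_inr_val, hds]
        rw [TEdge, tailP_val, peelP_α] at IH
        have hr : ∀ w : ↥P₀, w ∈ S.peelP.roots P₀ ↔ w ∈ S.roots P₀ := fun w ↦ by
          rw [h.roots_peelP hE' hb']
        exact Iff.trans (exists_congr fun w ↦ and_congr_left' (not_congr (hr w)).symm) IH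
  termination_by S => S.V.card
  decreasing_by
    all_goals first
      | (apply Good.card_peelP_lt <;> assumption)
      | (apply Good.card_peelE_lt <;> assumption)

end PeelData

end USTPeano

end Literature.Probability.RandomPlanarGeometry
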